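import Mathlib.CategoryTheory.Comma.Over.Basic
import Mathlib.CategoryTheory.ObjectProperty.FullSubcategory
import Mathlib.CategoryTheory.Limits.IsLimit
import Literature.AlgebraicGeometry.Frobenioids.Frobenioid
import Literature.AlgebraicGeometry.Frobenioids.CoprimarySteps
import Literature.AlgebraicGeometry.Frobenioids.BiratUnitsDiv
import Literature.AlgebraicGeometry.Frobenioids.PreFrobenioidDataToFunctor
import HarnessLib

/-!
# Frobenioids I, Definition 1.3 (iii)(d), slice form: the category `(C^coa-pre)_B` of co-angular pre-steps
# over `B` is the poset `Order(Φ(B))ᵒᵖ` — thin, ordered by divisibility of `(ψ^*)⁻¹ Div ψ`, and its limits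
# are least common multiples (PROOFS)

Mochizuki, *The geometry of Frobenioids I: the general theory*, Kyushu J. Math. **62** (2008)
293–400, Definition 1.3 (iii)(d) p. 24: "the natural functor … `(C^coa-pre)_A → Order(Φ(A))ᵒᵖ` …
[obtained by] `ψ ↦ (ψ^*)⁻¹(Div(ψ)) ∈ Φ(A)` … [is an] equivalence of categories"
[cite: MochizukiFrdI2008, Def. 1.3 (iii) p.24]; used in this literal categorical form by
[EtTh] Cor. 3.8, proof p.81 ("a [filtered] projective limit in the category `(C^pf)^coa-pre_B`").

PROOF-ONLY, generic over the operations `S : PreFrobenioidData C D` of a Frobenioid `S.toFunctor`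
(abc-iut cell; written for the row «EtTh:Cor3.8(i)/C38-L05», sub-rows L05a/L05b of
plan/L2/SUBDAG-EtTh-Cor38.md, whose `CoaPreOver P B` is literally the object type below at `S := P.ops`;
seat abc-iut-w5-d246).  For an object `B` let `(C^coa-pre)_B` denote the full subcategory of `Over B` on the
co-angular pre-steps (`ObjectProperty.FullSubcategory fun U : Over B => S.IsCoAngularPreStep U.hom`) and
`x_ψ := (ψ^*)⁻¹ Div ψ ∈ Φ(Base B)` (`PreFrobenioid.invDiv S.toFunctor ψ _`).  We prove:

* `coaPreOver_isPreStep_left` — every arrow of `Over B` between co-angular pre-steps is a pre-step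
  (Remark 1.1.1), co-angular when `C` is of isotropic type (`coaPreOver_isCoAngularPreStep_left`);
* `coaPreOver_subsingleton_hom` — `(C^coa-pre)_B` is THIN (pre-steps are monomorphisms, Def. 1.3 (v)(a));
* `coaPreOver_nonempty_hom_iff` — `Hom(U, V) ≠ ∅ ↔ x_V ∣ x_U` (Def. 1.3 (iii)(d), slice, full; and
  Remark 1.1.1 for the converse);
* `coaPreOver_exists_invDiv_eq` — every `x ∈ Φ(Base B)` is an `x_U` (Def. 1.3 (iii)(d), slice, essentially
  surjective);
* `coaPreOver_nonempty_isLimit_iff` — a cone over ANY diagram `K : J ⥤ (C^coa-pre)_B` is a limit cone iff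
  `x_{apex}` is a least common multiple of the `x_{K j}`: `∀ y, (∀ j, x_{K j} ∣ y) → x_{apex} ∣ y`
  (limits in the poset `Order(Φ(B))ᵒᵖ` are suprema for `∣`).
No new definitions; nothing here is specific to the abc programme.
-/

namespace Literature.AlgebraicGeometry.Frobenioids

namespace PreFrobenioidData

open CategoryTheory Opposite Limits PreFrobenioid

universe w v v' u u'

variable {C : Type u} [Category.{v} C] {D : Type u'} [Category.{v'} D] (S : PreFrobenioidData.{w} C D)
  {B : C}

/-! ### The objects and arrows of `(C^coa-pre)_B` in the functor language -/

/-- An object of `(C^coa-pre)_B` is a co-angular pre-step for the structure functor `S.toFunctor`.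
[cite: MochizukiFrdI2008, Def. 1.3 (iii) p.24] -/
theorem coaPreOver_isCoAngularPreStep_toFunctor
    (U : ObjectProperty.FullSubcategory fun U : Over B => S.IsCoAngularPreStep U.hom) :
    PreFrobenioid.IsCoAngularPreStep S.toFunctor U.obj.hom :=
  ⟨(ofFunctor_isCoAngular S.toFunctor U.obj.hom).mp U.property.1, U.property.2⟩

/-- Every arrow of `Over B` between co-angular pre-steps is a pre-step: linear and a base-isomorphism by
Remark 1.1.1. [cite: MochizukiFrdI2008, Rem. 1.1.1 p.21] -/
theorem coaPreOver_isPreStep_left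
    {U V : ObjectProperty.FullSubcategory fun U : Over B => S.IsCoAngularPreStep U.hom} (a : U ⟶ V) :
    S.IsPreStep a.hom.left := by
  have w : a.hom.left ≫ V.obj.hom = U.obj.hom := Over.w a.hom
  refine ⟨?_, ?_⟩
  · have e := S.degFr_comp a.hom.left V.obj.hom
    rw [w, show S.degFr U.obj.hom = 1 from U.property.2.1, show S.degFr V.obj.hom = 1 from V.property.2.1,
      mul_one] at e
    exact e.symm
  · haveI : IsIso (S.base.map V.obj.hom) := V.property.2.2
    haveI : IsIso (S.base.map a.hom.left ≫ S.base.map V.obj.hom) := by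
      rw [← Functor.map_comp, w]; exact U.property.2.2
    exact IsIso.of_isIso_comp_right (S.base.map a.hom.left) (S.base.map V.obj.hom)

/-- In a Frobenioid of isotropic type every arrow of `Over B` between co-angular pre-steps is a
co-angular pre-step (Prop. 1.4 (i)). [cite: MochizukiFrdI2008, Prop. 1.4 (i) p.26] -/
theorem coaPreOver_isCoAngularPreStep_left (histr : PreFrobenioid.IsOfIsotropicType S.toFunctor)
    {U V : ObjectProperty.FullSubcategory fun U : Over B => S.IsCoAngularPreStep U.hom} (a : U ⟶ V) :
    S.IsCoAngularPreStep a.hom.left :=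
  ⟨(ofFunctor_isCoAngular S.toFunctor a.hom.left).mpr
      (isCoAngular_of_isIsotropic_codomains S.toFunctor a.hom.left fun Z _ => histr Z),
    S.coaPreOver_isPreStep_left a⟩

/-! ### `(C^coa-pre)_B` is thin -/

/-- **`(C^coa-pre)_B` is a thin category**: pre-steps are monomorphisms (Def. 1.3 (v)(a)), so an arrow over
`B` into a pre-step is determined by its target. [cite: MochizukiFrdI2008, Def. 1.3 (v) p.25] -/
theorem coaPreOver_subsingleton_hom (hF : PreFrobenioid.IsFrobenioid S.toFunctor)
    (U V : ObjectProperty.FullSubcategory fun U : Over B => S.IsCoAngularPreStep U.hom) :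
    Subsingleton (U ⟶ V) := by
  refine ⟨fun a b => ?_⟩
  apply ObjectProperty.hom_ext
  apply Over.OverMorphism.ext
  haveI : Mono V.obj.hom := hF.v_a V.obj.hom V.property.2
  rw [← cancel_mono V.obj.hom, Over.w a.hom, Over.w b.hom]

/-- `(C^coa-pre)_B` is thin, as a `Quiver.IsThin` statement. [cite: MochizukiFrdI2008, Def. 1.3 (v) p.25] -/
theorem coaPreOver_isThin (hF : PreFrobenioid.IsFrobenioid S.toFunctor) :
    Quiver.IsThin (ObjectProperty.FullSubcategory fun U : Over B => S.IsCoAngularPreStep U.hom) :=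
  fun U V => S.coaPreOver_subsingleton_hom hF U V

/-! ### The order: `Hom(U, V) ≠ ∅ ↔ x_V ∣ x_U` -/

/-- An arrow `U → V` of `(C^coa-pre)_B` forces `x_V ∣ x_U` (Remark 1.1.1: `Div(a ≫ ψ) = a^* Div ψ + Div a`
for a linear `ψ`). [cite: MochizukiFrdI2008, Def. 1.3 (iii) p.24] -/
theorem coaPreOver_invDiv_dvd_of_hom
    {U V : ObjectProperty.FullSubcategory fun U : Over B => S.IsCoAngularPreStep U.hom} (a : U ⟶ V) :
    invDiv S.toFunctor V.obj.hom (S.coaPreOver_isCoAngularPreStep_toFunctor V).2.2 ∣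
      invDiv S.toFunctor U.obj.hom (S.coaPreOver_isCoAngularPreStep_toFunctor U).2.2 := by
  have w : a.hom.left ≫ V.obj.hom = U.obj.hom := Over.w a.hom
  have h' : PreFrobenioid.IsBaseIso S.toFunctor (a.hom.left ≫ V.obj.hom) := by
    rw [w]; exact (S.coaPreOver_isCoAngularPreStep_toFunctor U).2.2
  rw [← RatFrac.invDiv_congr S.toFunctor w h' (S.coaPreOver_isCoAngularPreStep_toFunctor U).2.2]
  exact invDiv_dvd_invDiv_comp a.hom.left V.obj.hom (S.coaPreOver_isCoAngularPreStep_toFunctor V).2 h'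

/-- **Def. 1.3 (iii)(d), slice, as an order isomorphism on hom-sets**: in a Frobenioid there is an arrow
`U → V` in `(C^coa-pre)_B` iff `x_V ∣ x_U` in `Φ(Base B)`. [cite: MochizukiFrdI2008, Def. 1.3 (iii) p.24] -/
theorem coaPreOver_nonempty_hom_iff (hF : PreFrobenioid.IsFrobenioid S.toFunctor)
    (U V : ObjectProperty.FullSubcategory fun U : Over B => S.IsCoAngularPreStep U.hom) :
    Nonempty (U ⟶ V) ↔
      invDiv S.toFunctor V.obj.hom (S.coaPreOver_isCoAngularPreStep_toFunctor V).2.2 ∣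
        invDiv S.toFunctor U.obj.hom (S.coaPreOver_isCoAngularPreStep_toFunctor U).2.2 := by
  refine ⟨fun ⟨a⟩ => S.coaPreOver_invDiv_dvd_of_hom a, fun hdvd => ?_⟩
  obtain ⟨g, -, hg⟩ := hF.iii_d_over_full U.obj.hom V.obj.hom (S.coaPreOver_isCoAngularPreStep_toFunctor U)
    (S.coaPreOver_isCoAngularPreStep_toFunctor V) hdvd
  exact ⟨ObjectProperty.homMk (Over.homMk g hg)⟩

/-! ### Essential surjectivity: every element of `Φ(Base B)` is an `x_U` -/

/-- **Def. 1.3 (iii)(d), slice, essentially surjective**, in the language of `(C^coa-pre)_B`: every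
`x ∈ Φ(Base B)` is `x_U` for an object `U`. [cite: MochizukiFrdI2008, Def. 1.3 (iii) p.24] -/
theorem coaPreOver_exists_invDiv_eq (hF : PreFrobenioid.IsFrobenioid S.toFunctor)
    (x : S.monFunctor.obj (op (baseObj S.toFunctor B))) :
    ∃ U : ObjectProperty.FullSubcategory fun U : Over B => S.IsCoAngularPreStep U.hom,
      invDiv S.toFunctor U.obj.hom (S.coaPreOver_isCoAngularPreStep_toFunctor U).2.2 = x := by
  obtain ⟨Y, ψ, h, hx⟩ := hF.iii_d_over_surj B x
  exact ⟨⟨Over.mk ψ, ⟨(ofFunctor_isCoAngular S.toFunctor ψ).mpr h.1, h.2⟩⟩, hx⟩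

/-! ### Limits in `(C^coa-pre)_B` are least common multiples -/

/-- A cone over a diagram `K` in `(C^coa-pre)_B` with apex `U` exists iff `x_{K j} ∣ x_U` for all `j`.
[cite: MochizukiFrdI2008, Def. 1.3 (iii) p.24] -/
theorem coaPreOver_nonempty_cone_iff (hF : PreFrobenioid.IsFrobenioid S.toFunctor) {J : Type*} [Category J]
    (K : J ⥤ ObjectProperty.FullSubcategory fun U : Over B => S.IsCoAngularPreStep U.hom)
    (U : ObjectProperty.FullSubcategory fun U : Over B => S.IsCoAngularPreStep U.hom) :
    Nonempty ((Functor.const J).obj U ⟶ K) ↔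
      ∀ j, invDiv S.toFunctor (K.obj j).obj.hom (S.coaPreOver_isCoAngularPreStep_toFunctor (K.obj j)).2.2 ∣
        invDiv S.toFunctor U.obj.hom (S.coaPreOver_isCoAngularPreStep_toFunctor U).2.2 := by
  refine ⟨fun ⟨π⟩ j => S.coaPreOver_invDiv_dvd_of_hom (π.app j), fun h => ?_⟩
  have hne : ∀ j, Nonempty (U ⟶ K.obj j) := fun j => (S.coaPreOver_nonempty_hom_iff hF U (K.obj j)).mpr (h j)
  refine ⟨{ app := fun j => (hne j).some, naturality := fun j j' f => ?_ }⟩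
  exact (S.coaPreOver_subsingleton_hom hF _ _).elim _ _

/-- **Limits in `(C^coa-pre)_B ≃ Order(Φ(Base B))ᵒᵖ` are suprema for divisibility**: a cone `c` over ANY
diagram `K : J ⥤ (C^coa-pre)_B` is a limit cone iff `x_{c.pt}` divides every common multiple of the
`x_{K j}` (it is itself a common multiple, `c` being a cone), i.e. iff `x_{c.pt} = sup_j x_{K j}` in
`(Φ(Base B), ∣)`.  In particular this applies to the "[filtered] projective limits in `(C^pf)^coa-pre_B`"
of [EtTh] Cor. 3.8. [cite: MochizukiFrdI2008, Def. 1.3 (iii) p.24] -/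
theorem coaPreOver_nonempty_isLimit_iff (hF : PreFrobenioid.IsFrobenioid S.toFunctor) {J : Type*} [Category J]
    {K : J ⥤ ObjectProperty.FullSubcategory fun U : Over B => S.IsCoAngularPreStep U.hom} (c : Cone K) :
    Nonempty (IsLimit c) ↔
      ∀ y : S.monFunctor.obj (op (baseObj S.toFunctor B)),
        (∀ j, invDiv S.toFunctor (K.obj j).obj.hom (S.coaPreOver_isCoAngularPreStep_toFunctor (K.obj j)).2.2 ∣ y) →
          invDiv S.toFunctor c.pt.obj.hom (S.coaPreOver_isCoAngularPreStep_toFunctor c.pt).2.2 ∣ y := by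
  constructor
  · rintro ⟨hc⟩ y hy
    obtain ⟨W, rfl⟩ := S.coaPreOver_exists_invDiv_eq hF (B := B) y
    obtain ⟨π⟩ := (S.coaPreOver_nonempty_cone_iff hF K W).mpr hy
    exact S.coaPreOver_invDiv_dvd_of_hom (hc.lift (Cone.mk W π))
  · intro h
    have hlift : ∀ s : Cone K, Nonempty (s.pt ⟶ c.pt) := fun s =>
      (S.coaPreOver_nonempty_hom_iff hF s.pt c.pt).mpr
        (h _ fun j => S.coaPreOver_invDiv_dvd_of_hom (s.π.app j))
    exact ⟨{ lift := fun s => (hlift s).some,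
             fac := fun s j => (S.coaPreOver_subsingleton_hom hF _ _).elim _ _,
             uniq := fun s m _ => (S.coaPreOver_subsingleton_hom hF _ _).elim _ _ }⟩

/-- **Existence of limits = existence of least common multiples**: a diagram `K` in `(C^coa-pre)_B` has a
limit cone iff the `x_{K j}` have a supremum for `∣` in `Φ(Base B)` (an element that is a common multiple
and divides every common multiple). [cite: MochizukiFrdI2008, Def. 1.3 (iii) p.24] -/
theorem coaPreOver_exists_isLimit_iff (hF : PreFrobenioid.IsFrobenioid S.toFunctor) {J : Type*} [Category J]
    (K : J ⥤ ObjectProperty.FullSubcategory fun U : Over B => S.IsCoAngularPreStep U.hom) :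
    (∃ c : Cone K, Nonempty (IsLimit c)) ↔
      ∃ x : S.monFunctor.obj (op (baseObj S.toFunctor B)),
        (∀ j, invDiv S.toFunctor (K.obj j).obj.hom (S.coaPreOver_isCoAngularPreStep_toFunctor (K.obj j)).2.2 ∣ x) ∧
          ∀ y : S.monFunctor.obj (op (baseObj S.toFunctor B)),
            (∀ j, invDiv S.toFunctor (K.obj j).obj.hom
                (S.coaPreOver_isCoAngularPreStep_toFunctor (K.obj j)).2.2 ∣ y) → x ∣ y := by
  constructor
  · rintro ⟨c, hc⟩
    exact ⟨_, (S.coaPreOver_nonempty_cone_iff hF K c.pt).mp ⟨c.π⟩, (S.coaPreOver_nonempty_isLimit_iff hF c).mp hc⟩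
  · rintro ⟨x, hx, hsup⟩
    obtain ⟨W, rfl⟩ := S.coaPreOver_exists_invDiv_eq hF (B := B) x
    obtain ⟨π⟩ := (S.coaPreOver_nonempty_cone_iff hF K W).mpr hx
    exact ⟨Cone.mk W π, (S.coaPreOver_nonempty_isLimit_iff hF (Cone.mk W π)).mpr hsup⟩

end PreFrobenioidData

end Literature.AlgebraicGeometry.Frobenioids
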